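import Mathlib
import HarnessLib

/-!
# Format C, design C∞: the free map `Λ` of the deflated certificate as a pair of data matrices

Route context: Fourier–Galerkin / Schur-complement certificates of Weil positivity on a window ("format C";
cell memo `run/shared/lean/pub/rh-explicit/rh-explicit-weil-10/KERNEL-LEVER.md` §19 (rung recipe, item (2)); supporting
stmt-RiemannHypothesis-0098; seat rh-explicit-weil-10).

The C∞ front door (`weilPositivityOn_of_formatC_cinf`) takes the rank-`r` correction's free map as a function
`Λ : (Fin B → ℝ) → (Fin r → ℝ) → Fin r → ℝ` with ONE analytic side condition, the `ℓ¹` bound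
`Σ_j |Λ(x,β)_j| ≤ λ(Σ_i |x_i| + Σ_j |β_j|)`.  The data side supplies two matrices; this file discharges the side condition:

* `sum_abs_matrixMap_le` — for `Λ(x,β)_j = Σ_i P(j,i)x_i + Σ_{j'} Q(j,j')β_{j'}`:
  `Σ_j |Λ(x,β)_j| ≤ (Σ_{j,i}|P(j,i)| + Σ_{j,j'}|Q(j,j')|)·(Σ_i|x_i| + Σ_j|β_j|)`.

Pure finite-dimensional real algebra; standard axioms; nothing Weil-specific; no RH claim.
-/

-- `Summit.RiemannHypothesis.RiemannHypothesis.…` is the layout-mandated namespace (summit = problem name).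
set_option linter.dupNamespace false

namespace Summit.RiemannHypothesis.RiemannHypothesis.Theorems.WeilFormatC

open Finset

/-- One coordinate is below the `ℓ¹` norm: `|z_k| ≤ Σ_k |z_k|`. -/
theorem abs_le_sum_abs {n : ℕ} (z : Fin n → ℝ) (k : Fin n) : |z k| ≤ ∑ k', |z k'| :=
  Finset.single_le_sum (f := fun k' ↦ |z k'|) (fun _ _ ↦ abs_nonneg _) (Finset.mem_univ k)

/-- **The `ℓ¹` bound of a matrix free map**: with `Λ(x,β)_j = Σ_i P(j,i)x_i + Σ_{j'} Q(j,j')β_{j'}`,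
`Σ_j |Λ(x,β)_j| ≤ (Σ_j Σ_i |P(j,i)| + Σ_j Σ_{j'} |Q(j,j')|)·(Σ_i |x_i| + Σ_j |β_j|)` — the hypothesis `hΛ` of
`weilPositivityOn_of_formatC_cinf` with `λ := Σ|P| + Σ|Q|`. -/
theorem sum_abs_matrixMap_le {B r : ℕ} (P : Fin r → Fin B → ℝ) (Q : Fin r → Fin r → ℝ)
    (x : Fin B → ℝ) (β : Fin r → ℝ) :
    ∑ j, |∑ i, P j i * x i + ∑ j', Q j j' * β j'|
      ≤ ((∑ j, ∑ i, |P j i|) + ∑ j, ∑ j', |Q j j'|) * (∑ i, |x i| + ∑ j, |β j|) := by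
  set X : ℝ := ∑ i, |x i| with hX
  set Y : ℝ := ∑ j, |β j| with hY
  have hX0 : 0 ≤ X := Finset.sum_nonneg fun _ _ ↦ abs_nonneg _
  have hY0 : 0 ≤ Y := Finset.sum_nonneg fun _ _ ↦ abs_nonneg _
  have hrow : ∀ j, |∑ i, P j i * x i + ∑ j', Q j j' * β j'| ≤ ((∑ i, |P j i|) + ∑ j', |Q j j'|) * (X + Y) := by
    intro j
    have h1 : |∑ i, P j i * x i| ≤ (∑ i, |P j i|) * (X + Y) := by
      calc |∑ i, P j i * x i| ≤ ∑ i, |P j i * x i| := Finset.abs_sum_le_sum_abs _ _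
        _ ≤ ∑ i, |P j i| * (X + Y) := Finset.sum_le_sum fun i _ ↦ by
            rw [abs_mul]
            exact mul_le_mul_of_nonneg_left ((abs_le_sum_abs x i).trans (by linarith)) (abs_nonneg _)
        _ = (∑ i, |P j i|) * (X + Y) := by rw [Finset.sum_mul]
    have h2 : |∑ j', Q j j' * β j'| ≤ (∑ j', |Q j j'|) * (X + Y) := by
      calc |∑ j', Q j j' * β j'| ≤ ∑ j', |Q j j' * β j'| := Finset.abs_sum_le_sum_abs _ _
        _ ≤ ∑ j', |Q j j'| * (X + Y) := Finset.sum_le_sum fun j' _ ↦ by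
            rw [abs_mul]
            exact mul_le_mul_of_nonneg_left ((abs_le_sum_abs β j').trans (by linarith)) (abs_nonneg _)
        _ = (∑ j', |Q j j'|) * (X + Y) := by rw [Finset.sum_mul]
    calc |∑ i, P j i * x i + ∑ j', Q j j' * β j'| ≤ |∑ i, P j i * x i| + |∑ j', Q j j' * β j'| := abs_add_le _ _
      _ ≤ (∑ i, |P j i|) * (X + Y) + (∑ j', |Q j j'|) * (X + Y) := add_le_add h1 h2
      _ = ((∑ i, |P j i|) + ∑ j', |Q j j'|) * (X + Y) := by ring
  calc ∑ j, |∑ i, P j i * x i + ∑ j', Q j j' * β j'| ≤ ∑ j, ((∑ i, |P j i|) + ∑ j', |Q j j'|) * (X + Y) :=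
        Finset.sum_le_sum fun j _ ↦ hrow j
    _ = ((∑ j, ∑ i, |P j i|) + ∑ j, ∑ j', |Q j j'|) * (X + Y) := by
        rw [← Finset.sum_mul, Finset.sum_add_distrib]

end Summit.RiemannHypothesis.RiemannHypothesis.Theorems.WeilFormatC
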